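import Literature.NumberTheory.Transcendental.KZCubeRationalMoves

/-!
# KontsevichZagierPeriods / HermiteRigidity — crux `ReductionRigidity` (stmt-KontsevichZagierPeriods-3407), line `Sketch` (Padé box island, every weight): TORUS EXACTNESS

Route `KontsevichZagierPeriods/HermiteRigidity`, crux stmt-KontsevichZagierPeriods-3407, crux-chain line `Sketch`
(skeleton `Cruxes/ReductionRigidity/Lines/Sketch.lean`, v7: the `(w, 1/N)` box island in every weight).
The lead's stub `stub_torusGen`: TORUS-EQUIVARIANT EXACTNESS on the closed unit cube `□^{j+1}` in every
dimension, at any RATIONAL level `ν > 1` or `ν < 0` (integer `N ≥ 2` registered). For `g = x^a/(ν − u)^m`,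
`u = x₀⋯x_j`, `a : Fin (j+1) → ℕ`, and two coordinates `i ≠ k`,

  `∂ᵢ(xᵢ g) = (aᵢ + 1)·g + m·g·u/(N − u)`,  `∂ₖ(xₖ g) = (aₖ + 1)·g + m·g·u/(N − u)`,

so `(aᵢ − aₖ)·g = ∂ᵢ(xᵢ g) − ∂ₖ(xₖ g)` EXACTLY (the torus field `xᵢ∂ᵢ − xₖ∂ₖ` kills `u`). With
`G = q/(aᵢ − aₖ)·g` (`aᵢ ≠ aₖ`), two cubical Stokes moves (`KZ.RFun.stokesAt`, rational primitives `xᵢG`,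
`xₖG` regular on the closed cube since `ν − u ≠ 0` there) give the congruence

  `[□^{j+1}, q·x^a/(ν − u)^m] ≡ [□ʲ, q/(aᵢ−aₖ)·(x^a/(ν−u)^m)|_{xᵢ=1}] − [□ʲ, q/(aᵢ−aₖ)·(x^a/(ν−u)^m)|_{xₖ=1}]`

in `KZ.relations` (the faces `xᵢ = 0`, `xₖ = 0` carry the factor `xᵢ`, `xₖ` and vanish). The partial
derivatives of the primitives are identified with the hand-computed one-variable derivatives through
`RFun.hasDerivAt_fn_update` (uniqueness of derivatives), not by symbolic `pderiv` algebra.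

References: M. Kontsevich, D. Zagier, *Periods* (2001), §1.2 rule (3) [cite: KontsevichZagier2001, §1.2];
J. Ayoub, EMS Newsl. 91 (2014), Def. 10 [cite: Ayoub2014, Def. 10].
-/

noncomputable section

open MeasureTheory Set MvPolynomial

namespace Summit.KontsevichZagierPeriods.HermiteRigidity.ReductionRigidity

open Literature.NumberTheory.Transcendental
open Literature.NumberTheory.Transcendental.KZ

/-! ## Tools: partial derivatives of regular rational functions as one-variable derivatives -/

/-- The partial derivative `T.pd i` evaluates, at a point of the closed cube, to the derivative of the
one-variable restriction `s ↦ T(p with pᵢ := s)` at `s = pᵢ` (quotient rule). [folklore] -/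
theorem torusGen_hasDerivAt_fn_update {M : ℕ} (T : RFun M) (i : Fin M) {p : Fin M → ℝ}
    (hp : p ∈ KZ.cube M) :
    HasDerivAt (fun s : ℝ => T.fn (Function.update p i s)) ((T.pd i).fn p) (p i) := by
  have hQ : aeval (Function.update p i (p i)) T.den ≠ 0 := by
    rw [Function.update_eq_self]; exact T.den_ne p hp
  have h := hasDerivAt_aeval_div_aeval_update T.num T.den p i (p i) hQ
  simp only [Function.update_eq_self] at h
  have hval : (T.pd i).fn p =
      (aeval p (pderiv i T.num) * aeval p T.den - aeval p T.num * aeval p (pderiv i T.den)) /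
        aeval p T.den ^ 2 := by
    simp only [RFun.fn, RFun.pd, map_sub, map_mul, map_pow]
  rw [hval]
  exact h

/-- Hence `(T.pd i).fn p = D` for any hand-computed derivative `D` of the restriction. [folklore] -/
theorem torusGen_pd_fn_eq {M : ℕ} (T : RFun M) (i : Fin M) {p : Fin M → ℝ} (hp : p ∈ KZ.cube M)
    {D : ℝ} (h : HasDerivAt (fun s : ℝ => T.fn (Function.update p i s)) D (p i)) : (T.pd i).fn p = D :=
  (torusGen_hasDerivAt_fn_update T i hp).unique h

/-! ## Products over `Fin (j+1)` along an updated / inserted coordinate -/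

/-- `∏ₗ (p with pᵢ := s)ₗ^{aₗ} = s^{aᵢ} · ∏_{l ≠ i} pₗ^{aₗ}` (the other factors do not see the update).
[folklore] -/
theorem torusGen_prod_pow_update {n : ℕ} (p : Fin n → ℝ) (a : Fin n → ℕ) (i : Fin n) (s : ℝ) :
    (∏ l, Function.update p i s l ^ a l) = s ^ a i * ∏ l ∈ Finset.univ.erase i, p l ^ a l := by
  rw [← Finset.mul_prod_erase _ _ (Finset.mem_univ i), Function.update_self]
  congr 1
  exact Finset.prod_congr rfl fun l hl => by rw [Function.update_of_ne (Finset.ne_of_mem_erase hl)]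

/-- `∏ₗ (p with pᵢ := s)ₗ = s · ∏_{l ≠ i} pₗ`. [folklore] -/
theorem torusGen_prod_update {n : ℕ} (p : Fin n → ℝ) (i : Fin n) (s : ℝ) :
    (∏ l, Function.update p i s l) = s * ∏ l ∈ Finset.univ.erase i, p l := by
  rw [← Finset.mul_prod_erase _ _ (Finset.mem_univ i), Function.update_self]
  congr 1
  exact Finset.prod_congr rfl fun l hl => by rw [Function.update_of_ne (Finset.ne_of_mem_erase hl)]

/-- `∏ₗ pₗ^{aₗ} = pᵢ^{aᵢ} · ∏_{l ≠ i} pₗ^{aₗ}`. [folklore] -/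
theorem torusGen_prod_pow_split {n : ℕ} (p : Fin n → ℝ) (a : Fin n → ℕ) (i : Fin n) :
    (∏ l, p l ^ a l) = p i ^ a i * ∏ l ∈ Finset.univ.erase i, p l ^ a l :=
  (Finset.mul_prod_erase _ _ (Finset.mem_univ i)).symm

/-- `∏ₗ pₗ = pᵢ · ∏_{l ≠ i} pₗ`. [folklore] -/
theorem torusGen_prod_split {n : ℕ} (p : Fin n → ℝ) (i : Fin n) :
    (∏ l, p l) = p i * ∏ l ∈ Finset.univ.erase i, p l :=
  (Finset.mul_prod_erase _ _ (Finset.mem_univ i)).symm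

/-- Along an inserted coordinate: `∏ₗ (insertNth i c y)ₗ^{aₗ} = c^{aᵢ} · ∏ₗ yₗ^{a (i.succAbove l)}`.
[folklore] -/
theorem torusGen_prod_pow_insertNth {j : ℕ} (i : Fin (j + 1)) (c : ℝ) (y : Fin j → ℝ)
    (a : Fin (j + 1) → ℕ) :
    (∏ l, (Fin.insertNth i c y l) ^ a l) = c ^ a i * ∏ l, y l ^ a (i.succAbove l) := by
  rw [Fin.prod_univ_succAbove _ i, Fin.insertNth_apply_same]
  congr 1
  exact Finset.prod_congr rfl fun l _ => by rw [Fin.insertNth_apply_succAbove]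

/-- Along an inserted coordinate: `∏ₗ (insertNth i c y)ₗ = c · ∏ₗ yₗ`. [folklore] -/
theorem torusGen_prod_insertNth {j : ℕ} (i : Fin (j + 1)) (c : ℝ) (y : Fin j → ℝ) :
    (∏ l, Fin.insertNth i c y l) = c * ∏ l, y l := by
  rw [Fin.prod_univ_succAbove _ i, Fin.insertNth_apply_same]
  congr 1
  exact Finset.prod_congr rfl fun l _ => by rw [Fin.insertNth_apply_succAbove]

/-! ## The primitive `xᵢ · G` and its Stokes move -/

/-- On the closed cube, `N − ∏ xₗ ≥ 1` for `N ≥ 2`. [folklore] -/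
theorem torusGen_one_le_sub_prod {n N : ℕ} (hN : 2 ≤ N) {p : Fin n → ℝ} (hp : p ∈ cube n) :
    (1 : ℝ) ≤ (N : ℝ) - ∏ l, p l := by
  have h2 : (2 : ℝ) ≤ (N : ℝ) := by exact_mod_cast hN
  have hle : (∏ l, p l) ≤ 1 := Finset.prod_le_one (fun l _ => (hp l).1) fun l _ => (hp l).2
  linarith

/-- On the closed cube, `ν − ∏ xₗ ≠ 0` for a rational level `ν > 1` or `ν < 0` (the product lies in `[0,1]`).
[folklore] -/
theorem torusGen_sub_prod_ne {n : ℕ} {ν : ℚ} (hν : 1 < ν ∨ ν < 0) {p : Fin n → ℝ} (hp : p ∈ cube n) :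
    (ν : ℝ) - ∏ l, p l ≠ 0 := by
  have hle : (∏ l, p l) ≤ 1 := Finset.prod_le_one (fun l _ => (hp l).1) fun l _ => (hp l).2
  have hge : 0 ≤ ∏ l, p l := Finset.prod_nonneg fun l _ => (hp l).1
  rcases hν with h | h
  · have : (1 : ℝ) < ν := by exact_mod_cast h
    intro h0; linarith
  · have : (ν : ℝ) < 0 := by exact_mod_cast h
    intro h0; linarith

/-- The denominator `(ν − ∏ X)^m` does not vanish on the closed cube. [folklore] -/
theorem torusGen_den_ne {n : ℕ} {ν : ℚ} (hν : 1 < ν ∨ ν < 0) (m : ℕ) :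
    ∀ p ∈ cube n, aeval p ((C ν - ∏ l, X l) ^ m : MvPolynomial (Fin n) ℚ) ≠ 0 := by
  intro p hp
  have h := torusGen_sub_prod_ne hν hp
  simp only [map_pow, map_sub, map_prod, aeval_C, eq_ratCast, aeval_X]
  exact pow_ne_zero _ h

/-- **One torus leg.** For the primitive `T = c·xᵢ·x^a/(N − u)^m` on `□ⁿ` (`n = j + 1`):
(i) the value of `∂ᵢ T` on the cube is `c·x^a·((aᵢ + 1)(N − u) + m·u)/(N − u)^{m+1}`;
(ii) its face `xᵢ = 1` is `c·∏ₗ yₗ^{a(i.succAbove l)}/(N − ∏ y)^m` and its face `xᵢ = 0` vanishes; hence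
`[□ⁿ, ∂ᵢT] ≡ [□ʲ, c·x^{a∘i.succAbove}/(N − u)^m]`. [cite: KontsevichZagier2001, §1.2 rule (3)] -/
theorem torusGen_leg {j : ℕ} {ν : ℚ} (hν : 1 < ν ∨ ν < 0) (c : ℚ) (a : Fin (j + 1) → ℕ) (m : ℕ)
    (i : Fin (j + 1)) (r₁ : IntegralRep j) (hr₁ : r₁.domain = cube j)
    (hr₁i : EqOn r₁.integrand (fun p => (c : ℝ) * (∏ l, p l ^ a (i.succAbove l)) /
      ((ν : ℝ) - ∏ l, p l) ^ m) (cube j)) :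
    ∃ T : RFun (j + 1),
      (∀ p ∈ cube (j + 1), (T.pd i).fn p = (c : ℝ) * (∏ l, p l ^ a l) *
        (((a i : ℝ) + 1) * ((ν : ℝ) - ∏ l, p l) + (m : ℝ) * ∏ l, p l) / ((ν : ℝ) - ∏ l, p l) ^ (m + 1)) ∧
      KZ.of (T.pd i).rep - KZ.of r₁ ∈ KZ.relations := by
  set T : RFun (j + 1) := ⟨C c * (X i * ∏ l, X l ^ a l), (C ν - ∏ l, X l) ^ m,
    torusGen_den_ne hν m⟩ with hT
  have hTfn : ∀ p : Fin (j + 1) → ℝ, T.fn p = (c : ℝ) * (p i * ∏ l, p l ^ a l) / ((ν : ℝ) - ∏ l, p l) ^ m := by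
    intro p
    simp [hT, RFun.fn, map_prod]
  refine ⟨T, fun p hp => ?_, ?_⟩
  · -- (i) the partial derivative, by uniqueness against the hand-computed one-variable derivative
    set K : ℝ := ∏ l ∈ Finset.univ.erase i, p l ^ a l with hK
    set M : ℝ := ∏ l ∈ Finset.univ.erase i, p l with hM
    have hfun : ∀ s : ℝ, T.fn (Function.update p i s) =
        ((c : ℝ) * K) * s ^ (a i + 1) / ((ν : ℝ) - M * s) ^ m := fun s => by
      rw [hTfn, torusGen_prod_pow_update, torusGen_prod_update, Function.update_self, ← hK, ← hM]
      ring
    have hden : (ν : ℝ) - M * p i ≠ 0 := by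
      have h1 := torusGen_sub_prod_ne hν hp
      rwa [torusGen_prod_split p i, mul_comm] at h1
    have hd := (((hasDerivAt_pow (a i + 1) (p i)).const_mul ((c : ℝ) * K)).div
      (((hasDerivAt_const (p i) (ν : ℝ)).sub ((hasDerivAt_id (p i)).const_mul M)).pow m)
      (pow_ne_zero _ hden))
    have key := torusGen_pd_fn_eq T i hp (hd.congr_of_eventuallyEq (Filter.Eventually.of_forall hfun))
    simp only [Pi.sub_apply, Pi.pow_apply, id] at key
    rw [key, torusGen_prod_pow_split p a i, torusGen_prod_split p i, ← hK, ← hM]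
    simp only [Nat.add_sub_cancel, Nat.cast_add, Nat.cast_one]
    have hden' : -(p i * M) + (ν : ℝ) ≠ 0 := fun h => hden (by linarith)
    have hden'' : (ν : ℝ) - p i * M ≠ 0 := fun h => hden (by linarith)
    rcases Nat.eq_zero_or_pos m with rfl | hm
    · simp only [pow_zero, Nat.cast_zero, zero_mul, mul_zero, sub_zero, zero_add, pow_one]
      field_simp
      ring
    · obtain ⟨m', rfl⟩ : ∃ m', m = m' + 1 := ⟨m - 1, by omega⟩
      simp only [Nat.add_sub_cancel, Nat.cast_add, Nat.cast_one]
      field_simp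
      ring
  · -- (ii) the Stokes move along `i` and its faces
    have hst := RFun.stokesAt i T
    have hface1 : KZ.of (T.faceAt i 1 ⟨zero_le_one, le_rfl⟩).rep - KZ.of r₁ ∈ KZ.relations := by
      refine of_sub_of_mem_relations_of_eqOn (hr₁.trans (RFun.rep_domain _).symm) fun y hy => ?_
      rw [RFun.rep_integrand, RFun.fn_faceAt, hTfn, Rat.cast_one, torusGen_prod_pow_insertNth,
        torusGen_prod_insertNth, Fin.insertNth_apply_same, hr₁i (by simpa [RFun.rep_domain] using hy)]
      simp
    have hface0 : KZ.of (T.faceAt i 0 ⟨le_rfl, zero_le_one⟩).rep ∈ KZ.relations := by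
      refine RFun.rel_of_eqOn_zero fun y _ => ?_
      rw [RFun.fn_faceAt, hTfn, Rat.cast_zero, Fin.insertNth_apply_same]
      simp
    have : KZ.of (T.pd i).rep - KZ.of r₁ =
        (KZ.of (T.pd i).rep - (KZ.of (T.faceAt i 1 ⟨zero_le_one, le_rfl⟩).rep -
          KZ.of (T.faceAt i 0 ⟨le_rfl, zero_le_one⟩).rep)) +
        (KZ.of (T.faceAt i 1 ⟨zero_le_one, le_rfl⟩).rep - KZ.of r₁) -
        KZ.of (T.faceAt i 0 ⟨le_rfl, zero_le_one⟩).rep := by abel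
    rw [this]
    exact KZ.relations.sub_mem (KZ.relations.add_mem hst hface1) hface0

/-- **Torus-equivariant exactness in every dimension, at a RATIONAL level `ν > 1` or `ν < 0`.** For
`i ≠ k` with `aᵢ ≠ aₖ`,
`[□^{j+1}, q x^a/(ν−u)^m] ≡ [□ʲ, q/(aᵢ−aₖ)·(x^a/(ν−u)^m)|_{xᵢ=1}] − [□ʲ, q/(aᵢ−aₖ)·(x^a/(ν−u)^m)|_{xₖ=1}]`
in `KZ.relations`: two cubical Stokes moves with the rational primitives `xᵢG`, `xₖG`
(`G = q/(aᵢ−aₖ)·x^a/(ν−u)^m`, regular on the closed cube since `ν − u ≠ 0` there) and the pointwise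
identity `q·g = ∂ᵢ(xᵢG) − ∂ₖ(xₖG)`. [cite: KontsevichZagier2001, §1.2 rule (3)] [cite: Ayoub2014, Def. 10] -/
theorem torusGen : ∀ (j : ℕ) (ν : ℚ), (1 < ν ∨ ν < 0) → ∀ (q : ℚ) (a : Fin (j + 1) → ℕ) (m : ℕ)
    (i k : Fin (j + 1)), i ≠ k → a i ≠ a k → ∀ (r : IntegralRep (j + 1)) (r₁ r₂ : IntegralRep j),
    r.domain = cube (j + 1) →
    EqOn r.integrand (fun p => (q : ℝ) * (∏ l, p l ^ a l) / ((ν : ℝ) - ∏ l, p l) ^ m) (cube (j + 1)) →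
    r₁.domain = cube j →
    EqOn r₁.integrand (fun p => ((q / ((a i : ℚ) - a k) : ℚ) : ℝ) * (∏ l, p l ^ a (i.succAbove l)) /
      ((ν : ℝ) - ∏ l, p l) ^ m) (cube j) →
    r₂.domain = cube j →
    EqOn r₂.integrand (fun p => ((q / ((a i : ℚ) - a k) : ℚ) : ℝ) * (∏ l, p l ^ a (k.succAbove l)) /
      ((ν : ℝ) - ∏ l, p l) ^ m) (cube j) →
    KZ.of r - (KZ.of r₁ - KZ.of r₂) ∈ KZ.relations := by
  intro j ν hν q a m i k _hik hak r r₁ r₂ hr hri hr₁ hr₁i hr₂ hr₂i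
  set c : ℚ := q / ((a i : ℚ) - a k) with hc
  obtain ⟨Ti, hTi, hlegi⟩ := torusGen_leg hν c a m i r₁ hr₁ hr₁i
  obtain ⟨Tk, hTk, hlegk⟩ := torusGen_leg hν c a m k r₂ hr₂ hr₂i
  have hak' : ((a i : ℝ) - a k) ≠ 0 := by
    have : ((a i : ℚ) - a k) ≠ 0 := sub_ne_zero.2 (by exact_mod_cast hak)
    exact_mod_cast this
  -- the pointwise identity `q g = ∂ᵢ(xᵢG) − ∂ₖ(xₖG)`
  have hsplit : KZ.of r - (KZ.of (Ti.pd i).rep - KZ.of (Tk.pd k).rep) ∈ KZ.relations := by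
    have h1 := RFun.rel_sub (Ti.pd i) (Tk.pd k)
    have h2 : KZ.of r - KZ.of ((Ti.pd i).sub (Tk.pd k)).rep ∈ KZ.relations := by
      refine of_sub_of_mem_relations_of_eqOn (by rw [RFun.rep_domain, hr]) fun p hp => ?_
      rw [hr] at hp
      rw [RFun.rep_integrand, RFun.fn_sub hp, hTi p hp, hTk p hp, hri hp, hc]
      have hden : (ν : ℝ) - ∏ l, p l ≠ 0 := torusGen_sub_prod_ne hν hp
      push_cast
      field_simp
      ring
    have : KZ.of r - (KZ.of (Ti.pd i).rep - KZ.of (Tk.pd k).rep) =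
        (KZ.of r - KZ.of ((Ti.pd i).sub (Tk.pd k)).rep) +
        (KZ.of ((Ti.pd i).sub (Tk.pd k)).rep - (KZ.of (Ti.pd i).rep - KZ.of (Tk.pd k).rep)) := by abel
    rw [this]
    exact KZ.relations.add_mem h2 h1
  have : KZ.of r - (KZ.of r₁ - KZ.of r₂) =
      (KZ.of r - (KZ.of (Ti.pd i).rep - KZ.of (Tk.pd k).rep)) +
      (KZ.of (Ti.pd i).rep - KZ.of r₁) - (KZ.of (Tk.pd k).rep - KZ.of r₂) := by abel
  rw [this]
  exact KZ.relations.sub_mem (KZ.relations.add_mem hsplit hlegi) hlegk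

/-- **STUB `torusGen` (lead, PROVED; the registered integer-level form `N ≥ 2`):** torus-equivariant
exactness in every dimension (`torusGen` at `ν = N`). [cite: KontsevichZagier2001, §1.2 rule (3)]
[cite: Ayoub2014, Def. 10] -/
theorem stub_torusGen : ∀ (j N : ℕ), 2 ≤ N → ∀ (q : ℚ) (a : Fin (j + 1) → ℕ) (m : ℕ) (i k : Fin (j + 1)),
    i ≠ k → a i ≠ a k → ∀ (r : IntegralRep (j + 1)) (r₁ r₂ : IntegralRep j),
    r.domain = cube (j + 1) →
    EqOn r.integrand (fun p => (q : ℝ) * (∏ l, p l ^ a l) / ((N : ℝ) - ∏ l, p l) ^ m) (cube (j + 1)) →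
    r₁.domain = cube j →
    EqOn r₁.integrand (fun p => ((q / ((a i : ℚ) - a k) : ℚ) : ℝ) * (∏ l, p l ^ a (i.succAbove l)) /
      ((N : ℝ) - ∏ l, p l) ^ m) (cube j) →
    r₂.domain = cube j →
    EqOn r₂.integrand (fun p => ((q / ((a i : ℚ) - a k) : ℚ) : ℝ) * (∏ l, p l ^ a (k.succAbove l)) /
      ((N : ℝ) - ∏ l, p l) ^ m) (cube j) →
    KZ.of r - (KZ.of r₁ - KZ.of r₂) ∈ KZ.relations := by
  intro j N hN q a m i k hik hak r r₁ r₂ hr hri hr₁ hr₁i hr₂ hr₂i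
  have hν : (1 : ℚ) < N ∨ (N : ℚ) < 0 := Or.inl (by exact_mod_cast hN)
  exact torusGen j N hν q a m i k hik hak r r₁ r₂ hr (fun p hp => by rw [hri hp]; push_cast; rfl)
    hr₁ (fun p hp => by rw [hr₁i hp]; push_cast; rfl) hr₂ (fun p hp => by rw [hr₂i hp]; push_cast; rfl)

end Summit.KontsevichZagierPeriods.HermiteRigidity.ReductionRigidity

end
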